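import Summits.BirchSwinnertonDyer.BirchSwinnertonDyer.Theorems.SemiOrdinaryEisensteinDescentShaTwoCochainBridgePackageMu
import Summits.BirchSwinnertonDyer.BirchSwinnertonDyer.Theorems.SemiOrdinaryEisensteinDescentShaTwoCochainLocalJoin
import Summits.BirchSwinnertonDyer.BirchSwinnertonDyer.Theorems.SemiOrdinaryEisensteinDescentShaTwoCochainLocalVanishing
import Literature.NumberTheory.GaloisCohomology.PoitouTateOddLevelRealPlaces
import HarnessLib

/-!
# The Ш²-cochain bridge, SUM OF LOCAL INVARIANTS: under `hPTc` for `f`, for `h : N₁ → C̄` with `Ψ h = θ′_* [f]` and a locally trivial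
# `γ`, the bridge's idèle `2`-cocycle `Z` (class image `h ∘ ∂γ`) has local Brauer invariants `inv_{K_v}[π_v Z|_v]` vanishing off a
# finite set and SUMMING TO ZERO over the finite places, and every local class `(m·m)`-torsion (steps (P)+(D)+glue-L of SHA2-BRIDGE-w3g7)

Route `SemiOrdinaryEisensteinDescent` (BSD), Kolyvagin column, Cassels–Tate lane: print item `CasselsTateLevelInputsFact`
(stmt-BirchSwinnertonDyer-20191), binder `hbridge` of `ShaTwoCochainTheta.casselsTate_levelInputs_of_readout_vanishing(_flip)`
(p638776 / p639762).  This file composes, at level `n = m·m` for the descended pairing data `(W, m, e)` of `hPTc`: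
the `μₙ`-currency bridge package `exists_bridgePackageMu` (p641526), glue-L `ShaTwoCochainTheta.evFlip_support_and_sum_eq_zero_of_class_eq`
(w4 g2, p640244: every admissible evaluation-pairing choice for `(F♭, γ)` has canonical local terms with a finite support and sum
zero), the per-place join `brauerInvariantEquiv_localProjection_eq_zmodToQmodZ_canonical` (p641898) and the odd-level archimedean
vanishing `LocalInvariants.canonical_inl_eq_zero_of_odd`.  What is LEFT for `hbridge` after this file is step S3b alone (w2 g11):
`classBarInv K (Φ⁻¹[γ] ∘ ∂h) = Σ_v inv_{K_v}[π_v Z|_v]` for an idèle `2`-cocycle `Z` with `jC ∘ Z = h ∘ c`, `[c] = δ₁[γ]`.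

* **`exists_bridge_sum_localInvariants_eq_zero`** — for `m` odd, `H³(K, μ_{m²}) = 0`, `hPTc` for `f`, `Ψ h = θ′_*[f]`, `γ` locally
  trivial and any family of idèle projections `π_v`: THERE ARE `c ∈ Z²(K, N₁)`, `h̃ : Hom(N₁, J̄)`, `Z ∈ Z²(K, J̄)` and a finite
  `S' ⊆ Place K` with (3) `jC ∘ h̃ = h`, (4) `δ₁[γ] = [c]`, (5) `jC (Z(σ,τ)) = h (c(σ,τ))`, and
  (a) for every finite `v ∉ S'` and every continuous `K̄_vˣ`-cocycle `c_Z` with `c_Z(s,t) = π_v Z(θs,θt)`: `inv_{K_v}[c_Z] = 0`;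
  (b) for every finite set `T` of finite places containing the finite part of `S'` and every such family `c_{Z,v}`:
      `Σ_{v ∈ T} inv_{K_v}[c_{Z,v}] = 0`;
  (c) at every place `v`, every such `c_Z` has `(m·m) • [c_Z] = 0` (so archimedean invariants of `Z` vanish for odd `m`).

Width seat `bsd-wall-soed-p2-w3` g7; `--supports stmt-BirchSwinnertonDyer-20480`, helper.  THEOREMS ONLY; no case of BSD,
Poitou–Tate or Cassels–Tate is proved here (the CT/PT inputs of the route are being discharged in the kernel, nothing more).

## References
* [MilneADT2006] J. S. Milne, *Arithmetic Duality Theorems*, 2nd ed. (2006), I §1, Lemma 4.13, Thm. 4.10 (a) (proof, pp. 57–58),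
  §6 proof of Prop. 6.9, Thm. 6.13 (a).
* [CasselsFrohlichANT1967] J. W. S. Cassels, A. Fröhlich (eds.), *Algebraic Number Theory* (1967), Ch. VII §7.3, §11.2 (bis).
-/

noncomputable section

open scoped Classical

-- `Summit.<P>.<Sub>` repeats `BirchSwinnertonDyer` by the tree's layout convention (D-0017)
set_option linter.dupNamespace false
set_option autoImplicit false

namespace Summit.BirchSwinnertonDyer.BirchSwinnertonDyer.Theorems.ShaTwoCochain

open CategoryTheory _root_.WeierstrassCurve Field Function NumberField IsDedekindDomain
open Literature.NumberTheory.EllipticCurves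
open Literature.NumberTheory.GaloisRepresentations Literature.NumberTheory.GaloisRepresentations.HomDual
  Literature.NumberTheory.GaloisCohomology
open Literature.Algebra.Homology Literature.Algebra.Homology.DiscreteRep ContRepresentation Literature
open Literature.NumberTheory.GaloisRepresentations.DiscreteGaloisModule (units UnitsCarrier mu MuCarrier TateDual tateDual
  tateDualPairing pairingDualIntertwining)
open Literature.NumberTheory.GaloisRepresentations.IdeleClassBar (classBarD)
open Literature.NumberTheory.GaloisRepresentations.FreePresentation
open Literature.NumberTheory.GaloisRepresentations.DGMBridge
open Literature.AnabelianGeometry.AbsoluteAnabelian (Prop121vii.brauerInvariantEquiv Prop121vii.zmodToQmodZ)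
open scoped ContRepresentation NumberField

variable {K : Type} [Field K] [NumberField K] {W : WeierstrassCurve K} {m : ℕ} [NeZero m]
variable {e : geomTorsion W ((m * m : ℕ) : ℤ) → geomTorsion W ((m * m : ℕ) : ℤ) → AlgebraicClosure K}
  {hμ : ∀ S T, e S T ^ (m * m) = 1}
  {hadd₁ : ∀ S₁ S₂ T, e (S₁ + S₂) T = e S₁ T * e S₂ T}
  {hadd₂ : ∀ S T₁ T₂, e S (T₁ + T₂) = e S T₁ * e S T₂}
  {hgal : ∀ (σ : absoluteGaloisGroup K) (S T : geomTorsion W ((m * m : ℕ) : ℤ)), σ • e S T = e (σ • S) (σ • T)}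
variable [Finite (geomTorsion W (m : ℤ))]

/-- **The bridge's idèle cocycle has local invariants with finite support, zero finite-place sum, and `(m·m)`-torsion local classes**
— see the module docstring. [cite: MilneADT2006, I Thm. 4.10 (a) (proof, pp. 57–58), §6 proof of Prop. 6.9]
[cite: CasselsFrohlichANT1967, Ch. VII §11.2 (bis)] -/
theorem exists_bridge_sum_localInvariants_eq_zero [NeZero (m * m)] (hm : Odd m)
    (hH3 : ∀ z : galoisCohomology (mu K (m * m)) 3, z = 0)
    {f : contTwoCocycles (W.torsionGaloisModule (m : ℤ)).toTopRep}
    (hf : ∀ g : contOneCocycles (W.torsionGaloisModule (m : ℤ)).toTopRep,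
      (∀ v : Place K, locClass (W.torsionGaloisModule (m : ℤ)) (Place.Completion v)
          (resOne (W.torsionGaloisModule (m : ℤ)) (Place.Completion v) g) = 0) →
      ∃ (C : PTChoice W m e hμ hadd₁ hadd₂ hgal f g) (S : Finset (Place K)),
        (∀ v ∉ S, C.localTerm (LocalInvariants.canonical K (m * m)) v = 0) ∧
          ∑ v ∈ S, C.localTerm (LocalInvariants.canonical K (m * m)) v = 0)
    (h : (presentationComplex (W.torsionGaloisModule (m : ℤ))).X₁ ⟶ classBarD K)
    (hh : shaTwoConnecting (W.torsionGaloisModule (m : ℤ)) (m * m)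
        (FirstCaseData.mul_nsmul_geomTorsion_eq_zero (W := W) (m := m)) h =
      galoisCohomology.map (pairingDualIntertwining
        (ρ₁ := W.torsionGaloisModule (m : ℤ)) (ρ₂ := W.torsionGaloisModule (m : ℤ))
        (B := (descendHom W m m e hμ hadd₁ hadd₂).flip) (ShaTwoCochainTheta.descendHom_flip_smul W m e hμ hadd₁ hadd₂ hgal)) 2
        (twoCocycleClass _ f))
    {γ : contOneCocycles (W.torsionGaloisModule (m : ℤ)).toTopRep}
    (hγ : ∀ v : Place K, locClass (W.torsionGaloisModule (m : ℤ)) (Place.Completion v)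
      (resOne (W.torsionGaloisModule (m : ℤ)) (Place.Completion v) γ) = 0)
    (πs : (v : Place K) → HomDual.IdeleProjection K v) :
    haveI := moduleFinite_presModule₁ (W.torsionGaloisModule (m : ℤ))
    haveI := absoluteGaloisGroup_compactSpace K
    ∃ (c : contTwoCocycles (presModule₁ (W.torsionGaloisModule (m : ℤ))).toTopRep)
      (ht : DiscreteRep.HomCarrier (LCarrier (presentationComplex (W.torsionGaloisModule (m : ℤ))).X₁) (LCarrier (ideleBarD K)))
      (Z : contTwoCocycles (toDGM (ideleBarD K)).toTopRep) (S' : Finset (Place K)),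
      -- (3) `h̃` lifts `h`
      (∀ x : LCarrier (presentationComplex (W.torsionGaloisModule (m : ℤ))).X₁,
        ideleToClassI K ((show _ →ₗ[ℤ] LCarrier (ideleBarD K) from ht) x) =
          lmap (presentationComplex (W.torsionGaloisModule (m : ℤ))).X₁ (classBarD K) h x) ∧
      -- (4) `[c] = δ₁[γ]`
      (pres_isSES (W.torsionGaloisModule (m : ℤ))).δ₁ (oneCocycleClass _ γ) = twoCocycleClass _ c ∧
      -- (5) `jC ∘ Z = h ∘ c`
      (∀ σ τ : absoluteGaloisGroup K,
        ideleToClassI K (Z.1 (σ, τ)) = lmap (presentationComplex (W.torsionGaloisModule (m : ℤ))).X₁ (classBarD K) h (c.1 (σ, τ))) ∧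
      -- (a) off `S'` the finite local invariants of `Z` vanish
      (∀ (v : HeightOneSpectrum (𝓞 K))
        (cZ : haveI := charZero_adicCompletion v; contTwoCocycles (units (v.adicCompletion K)).toTopRep),
        (∀ s t : absoluteGaloisGroup (v.adicCompletion K), cZ.1 (s, t) =
          ((πs (Sum.inr v)).toAddMonoidHom.comp (LCarrier.val (ideleBarD K)))
            (Z.1 (absGaloisRestrict K (v.adicCompletion K) s, absGaloisRestrict K (v.adicCompletion K) t))) →
        (Sum.inr v : Place K) ∉ S' →
        (haveI := charZero_adicCompletion v; haveI := absoluteGaloisGroup_compactSpace (v.adicCompletion K);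
          Prop121vii.brauerInvariantEquiv (v.adicCompletion K) (twoCocycleClass (units (v.adicCompletion K)).toTopRep cZ)) = 0) ∧
      -- (b) the finite-place sum of the local invariants of `Z` vanishes
      (∀ (T : Finset (HeightOneSpectrum (𝓞 K))), (∀ v : HeightOneSpectrum (𝓞 K), (Sum.inr v : Place K) ∈ S' → v ∈ T) →
        ∀ (cZs : (v : HeightOneSpectrum (𝓞 K)) →
            haveI := charZero_adicCompletion v; contTwoCocycles (units (v.adicCompletion K)).toTopRep),
          (∀ (v : HeightOneSpectrum (𝓞 K)) (s t : absoluteGaloisGroup (v.adicCompletion K)), (cZs v).1 (s, t) =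
            ((πs (Sum.inr v)).toAddMonoidHom.comp (LCarrier.val (ideleBarD K)))
              (Z.1 (absGaloisRestrict K (v.adicCompletion K) s, absGaloisRestrict K (v.adicCompletion K) t))) →
          ∑ v ∈ T, (haveI := charZero_adicCompletion v; haveI := absoluteGaloisGroup_compactSpace (v.adicCompletion K);
            Prop121vii.brauerInvariantEquiv (v.adicCompletion K)
              (twoCocycleClass (units (v.adicCompletion K)).toTopRep (cZs v))) = 0) ∧
      -- (c) every local class of `Z` is `(m·m)`-torsion
      (∀ (v : Place K) (cZ : contTwoCocycles (units (Place.Completion v)).toTopRep),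
        (∀ s t : absoluteGaloisGroup (Place.Completion v), cZ.1 (s, t) =
          ((πs v).toAddMonoidHom.comp (LCarrier.val (ideleBarD K)))
            (Z.1 (absGaloisRestrict K (Place.Completion v) s, absGaloisRestrict K (Place.Completion v) t))) →
        (haveI := absoluteGaloisGroup_compactSpace (Place.Completion v);
          (m * m) • twoCocycleClass (units (Place.Completion v)).toTopRep cZ) = 0) := by
  haveI := moduleFinite_presModule₁ (W.torsionGaloisModule (m : ℤ))
  haveI := moduleFinite_presModule₂ (W.torsionGaloisModule (m : ℤ))
  haveI := absoluteGaloisGroup_compactSpace K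
  have hn : Odd (m * m) := Nat.odd_mul.2 ⟨hm, hm⟩
  -- the `μ`-currency bridge package
  obtain ⟨Fb, Hb, c, ht, Z, h1, h2, h3, h4, h5, h6⟩ := exists_bridgePackageMu (W.torsionGaloisModule (m : ℤ)) (m * m)
    (FirstCaseData.mul_nsmul_geomTorsion_eq_zero (W := W) (m := m)) hH3 h γ
  choose φb lam hφb h6b using h6
  -- glue-L: the canonical local terms of the bridge's choice `(H♭; φ♭_v)` have finite support and sum zero
  have hclass : galoisCohomology.map (pairingDualIntertwining
        (ρ₁ := W.torsionGaloisModule (m : ℤ)) (ρ₂ := W.torsionGaloisModule (m : ℤ))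
        (B := (descendHom W m m e hμ hadd₁ hadd₂).flip) (ShaTwoCochainTheta.descendHom_flip_smul W m e hμ hadd₁ hadd₂ hgal)) 2
        (twoCocycleClass _ f) = twoCocycleClass _ Fb := hh.symm.trans h1
  obtain ⟨S', hoff, hsum⟩ := ShaTwoCochainTheta.evFlip_support_and_sum_eq_zero_of_class_eq hf Fb hclass hγ Hb h2
    (fun v => φb v (πs v)) (fun v => hφb v (πs v))
  -- abbreviation: the canonical local term at `v`
  set t : (v : Place K) → ZMod (m * m) := fun v => LocalInvariants.canonical K (m * m) v
    (locClass₂ (mu K (m * m)) (Place.Completion v)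
      ((((tateDualPairing (W.torsionGaloisModule (m : ℤ)) (m * m)).flip).restrict
          (absGaloisRestrict K (Place.Completion v))).cupSubCocycle (φb v (πs v))
        (resOne (W.torsionGaloisModule (m : ℤ)) (Place.Completion v) γ)
        (resTwo ((W.torsionGaloisModule (m : ℤ)).tateDual (m * m)) (Place.Completion v) Fb) (hφb v (πs v))
        (resCochain₂ (Place.Completion v) Hb)
        (dTwo_resCochain₂_of_cupCocycle₂₁ ((tateDualPairing (W.torsionGaloisModule (m : ℤ)) (m * m)).flip)
          (fun v => ((tateDualPairing (W.torsionGaloisModule (m : ℤ)) (m * m)).flip).restrict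
            (absGaloisRestrict K (Place.Completion v)))
          (fun _ _ _ => rfl) Hb h2 v))) with ht_def
  have hoff' : ∀ v ∉ S', t v = 0 := hoff
  have hsum' : ∑ v ∈ S', t v = 0 := hsum
  -- the per-place join at a finite place
  have hjoin : ∀ (v : HeightOneSpectrum (𝓞 K))
      (cZ : haveI := charZero_adicCompletion v; contTwoCocycles (units (v.adicCompletion K)).toTopRep),
      (∀ s t : absoluteGaloisGroup (v.adicCompletion K), cZ.1 (s, t) =
        ((πs (Sum.inr v)).toAddMonoidHom.comp (LCarrier.val (ideleBarD K)))
          (Z.1 (absGaloisRestrict K (v.adicCompletion K) s, absGaloisRestrict K (v.adicCompletion K) t))) →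
      (haveI := charZero_adicCompletion v; haveI := absoluteGaloisGroup_compactSpace (v.adicCompletion K);
        Prop121vii.brauerInvariantEquiv (v.adicCompletion K) (twoCocycleClass (units (v.adicCompletion K)).toTopRep cZ)) =
        Prop121vii.zmodToQmodZ (m * m) (t (Sum.inr v)) := fun v cZ hcZ =>
    brauerInvariantEquiv_localProjection_eq_zmodToQmodZ_canonical (W.torsionGaloisModule (m : ℤ)) (m * m) v Fb γ Hb h2
      (φb (Sum.inr v) (πs (Sum.inr v))) (hφb (Sum.inr v) (πs (Sum.inr v))) (lam (Sum.inr v) (πs (Sum.inr v))) Z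
      (πs (Sum.inr v)) cZ hcZ (h6b (Sum.inr v) (πs (Sum.inr v)))
  refine ⟨c, ht, Z, S', h3, h4, h5, fun v cZ hcZ hv => ?_, fun T hT cZs hcZs => ?_, fun v cZ hcZ => ?_⟩
  · -- (a)
    rw [hjoin v cZ hcZ, hoff' _ hv, map_zero]
  · -- (b): `Σ_{v ∈ T} inv_v = zmodToQmodZ (Σ_{v ∈ T} t (inr v)) = zmodToQmodZ (Σ_{w ∈ S'} t w) = 0`
    rw [Finset.sum_congr rfl fun v _ => hjoin v (cZs v) (hcZs v), ← map_sum]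
    have hTS : ∑ v ∈ T, t (Sum.inr v) = ∑ w ∈ S', t w := by
      have hmap : ∑ w ∈ T.map ⟨(Sum.inr : HeightOneSpectrum (𝓞 K) → Place K), Sum.inr_injective⟩, t w =
          ∑ v ∈ T, t (Sum.inr v) := Finset.sum_map _ _ _
      rw [← hmap]
      -- both sums agree with the sum over the union (the extra terms vanish)
      rw [Finset.sum_subset (Finset.subset_union_right (s₁ := S')) fun w _ hw => ?_,
        Finset.sum_subset (Finset.subset_union_left (s₂ := T.map ⟨Sum.inr, Sum.inr_injective⟩)) fun w _ hw => hoff' w hw]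
      -- `w ∈ S' ∪ T.map inr`, `w ∉ T.map inr`: then `t w = 0`
      rcases w with w | v
      · exact LocalInvariants.canonical_inl_eq_zero_of_odd hn w _
      · by_cases hv : (Sum.inr v : Place K) ∈ S'
        · exact absurd (Finset.mem_map.2 ⟨v, hT v hv, rfl⟩) hw
        · exact hoff' _ hv
    rw [hTS, hsum', map_zero]
  · -- (c): `c_Z − dλ` has `μ_{m²}`-sourced values
    haveI := absoluteGaloisGroup_compactSpace (Place.Completion v)
    let z := (((tateDualPairing (W.torsionGaloisModule (m : ℤ)) (m * m)).flip).restrict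
        (absGaloisRestrict K (Place.Completion v))).cupSubCocycle (φb v (πs v))
      (resOne (W.torsionGaloisModule (m : ℤ)) (Place.Completion v) γ)
      (resTwo ((W.torsionGaloisModule (m : ℤ)).tateDual (m * m)) (Place.Completion v) Fb) (hφb v (πs v))
      (resCochain₂ (Place.Completion v) Hb)
      (dTwo_resCochain₂_of_cupCocycle₂₁ ((tateDualPairing (W.torsionGaloisModule (m : ℤ)) (m * m)).flip)
        (fun v => ((tateDualPairing (W.torsionGaloisModule (m : ℤ)) (m * m)).flip).restrict
          (absGaloisRestrict K (Place.Completion v)))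
        (fun _ _ _ => rfl) Hb h2 v)
    let z' : contTwoCocycles (units (Place.Completion v)).toTopRep := cZ - (units (Place.Completion v)).twoCoboundary (lam v (πs v))
    have hz' : ∀ s t : absoluteGaloisGroup (Place.Completion v),
        z'.1 (s, t) = unitsTransferAddHom K (Place.Completion v) (kummerInclAddHom K (m * m) (z.1 (s, t))) := by
      intro s t
      change cZ.1 (s, t) - ((units (Place.Completion v)).twoCoboundary (lam v (πs v))).1 (s, t) = _
      rw [hcZ, ContinuousRep.twoCoboundary_apply, ContPairing.cupSubCocycle_apply, ContPairing.restrict_toLin,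
        ContPairing.flip_toLin_apply]
      exact (h6b v (πs v) s t).symm
    have hcl : twoCocycleClass (units (Place.Completion v)).toTopRep cZ = twoCocycleClass _ z' := by
      change _ = twoCocycleClass _ (cZ - (units (Place.Completion v)).twoCoboundary (lam v (πs v)))
      rw [twoCocycleClass_sub, ContinuousRep.twoCocycleClass_twoCoboundary, sub_zero]
    have hz'0 : (m * m) • z' = 0 := by
      refine Subtype.ext (ContinuousMap.ext fun st => ?_)
      obtain ⟨s, t⟩ := st
      change (m * m) • z'.1 (s, t) = 0
      rw [hz', ← map_nsmul, ← map_nsmul, ← natCast_zsmul, zsmul_muCarrier_eq_zero, map_zero, map_zero]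
    rw [hcl, ← twoCocycleClassₗ_apply, ← map_nsmul, hz'0, map_zero]

end Summit.BirchSwinnertonDyer.BirchSwinnertonDyer.Theorems.ShaTwoCochain

end
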